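import Summits.CriticalPhenomena.Ising3D.Control2DVertexAlgebra
import Mathlib.Tactic
import HarnessLib

/-!
# The free-boson vertex-operator witness, II: the Casimir recursions matching
`k_2 k_{2a} = Σ_k E_k(a) k_{2(a+1+2k)}` and `x^{2q}(1-x)^{-q} = Σ_k γ_k(q) k_{4q+4k}` coefficientwise
(cell `pub-ising3x`, seat controls-1 gen 36; NON-VACUITY of the 2D control's hypothesis classes WITH a
stress tensor, step 2 of 4 — CONTROL-ONLY)

HONEST FRAMING: lottery ticket; floor = tightest certified 3D Ising CFT bounds; no exact-solution
claim without a proof. CONTROL-ONLY (`d = 2`); nothing numerical is asserted here.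

Method (both identities): the coefficient form of the `sl(2)` Casimir `D = x²(1-x)∂² - x²∂`,
`n(2h+n-1) κ_h(n) = (h+n-1)² κ_h(n-1)` (`chiralCoeff_succ_rec`), turns a block expansion
`f = Σ_k c_k k_{2h_k}` into a first-order recursion WITH SOURCE for the power-series coefficients of `f`;
two coefficient sequences obeying the same recursion from the same start agree.

* `vtxW a M = Σ_{i+n=M-1} κ_a(n)/(i+1)` — the power-series coefficients of the product `k_2(x) k_{2a}(x)`
  (`k_2 = Σ_i x^{i+1}/(i+1) = -log(1-x)`), and `vtxW' a M = Σ_{2k ≤ M-1} E_k(a) κ_{a+1+2k}(M-1-2k)` — those of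
  `Σ_k E_k(a) k_{2(a+1+2k)}(x)` — both satisfy `M(2a+M-1) X_M = (a+M-1)² X_{M-1} + 2(a+M-1) κ_a(M-1)`
  (`vtxW_rec`: the coefficient form of `(D - a(a-1))(k_2 k_{2a}) = 2x² k_{2a}'`; `vtxW'_rec`: eigenvalue
  differences `2(2k+1)(a+k)` and `vtx_defect_sum`), hence **`vtxW_eq_vtxW'`**;
* `vtxGamma k q` (`γ_0 = 1`, `γ_{k+1}(q) = q² γ_k(q+1)/(2(k+1)(4q+2k+1))`, i.e.
  `γ_k(q) = (q)_k²/(4^k k! (2q+k-1/2)_k) > 0`), `vtxY q m = (q)_m/m!` (coefficients of `x^{2q}(1-x)^{-q}`)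
  and `vtxWG q m = Σ_{2k ≤ m} γ_k(q) κ_{2q+2k}(m-2k)` both satisfy
  `(m+2)(4q+m+1) X_{m+2}(q) = (2q+m+1)² X_{m+1}(q) + q² X_m(q+1)` (`vtxY_rec`: coefficient form of
  `(D - 2q(2q-1)) (x^{2q}(1-x)^{-q}) = q² x^{2q+2}(1-x)^{-q-1}`; `vtxWG_rec`: eigenvalue differences
  `2k(4q+2k-1)`), hence **`vtxY_eq_vtxWG`**.

Finite algebra only; the series are summed in `Control2DVertexChiral`. All identities were pre-checked in
exact rational arithmetic (HOME/pub-ising3x-controls-1/KP21/sym/verify_all.py).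

References: F. A. Dolan, H. Osborn, arXiv:1108.6194, §2 eq. (2.11) (the `sl(2)` Casimir on `k_{2h}`)
[cite: DolanOsborn2011, §2 eq. (2.11)]; Ph. Di Francesco, P. Mathieu, D. Sénéchal, Conformal Field Theory
(Springer 1997), §9.1 (the vertex-operator four-point function these expansions decompose)
[cite: DiFrancescoMathieuSenechal1997, §9.1]. Tree: `chiralCoeff`, `chiralCoeff_succ_rec`, `vtxC`, `vtxE`,
`vtxE_mul`, `vtxE_zero`, `vtx_defect_sum` (`Control2DVertexAlgebra`), `poch` + lemmas
(`Literature/…/ConformalBootstrap3D/MeanFieldCoefficients`).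
-/

namespace Summit.CriticalPhenomena.Ising3D.Control2D

open Finset
open Literature.MathematicalPhysics.QuantumFieldTheory.ConformalBootstrap3D

/-! ### The two coefficient sequences of `k_2 k_{2a}` and `Σ_k E_k(a) k_{2(a+1+2k)}` -/

/-- The power-series coefficients of the product `k_2(x) k_{2a}(x) = Σ_M W_M x^{a+M}`:
`W_0 = 0`, `W_{L+1} = Σ_{i+n=L} κ_a(n)/(i+1)` (Cauchy product with `k_2 = Σ_i x^{i+1}/(i+1)`). [folklore] -/
noncomputable def vtxW (a : ℝ) : ℕ → ℝ
  | 0 => 0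
  | L + 1 => ∑ p ∈ antidiagonal L, chiralCoeff a p.2 / ((p.1 : ℝ) + 1)

/-- The power-series coefficients of `Σ_k E_k(a) k_{2(a+1+2k)}(x) = Σ_M W'_M x^{a+M}`:
`W'_0 = 0`, `W'_{L+1} = Σ_{2k ≤ L} E_k(a) κ_{a+1+2k}(L-2k)`. [folklore] -/
noncomputable def vtxW' (a : ℝ) : ℕ → ℝ
  | 0 => 0
  | L + 1 => ∑ k ∈ range (L + 1),
      if 2 * k ≤ L then vtxE a k * chiralCoeff (a + 1 + 2 * k) (L - 2 * k) else 0

/-- Unfolding `W_{L+1}`. [folklore] -/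
theorem vtxW_succ (a : ℝ) (L : ℕ) :
    vtxW a (L + 1) = ∑ p ∈ antidiagonal L, chiralCoeff a p.2 / ((p.1 : ℝ) + 1) := rfl

/-- Unfolding `W'_{L+1}`. [folklore] -/
theorem vtxW'_succ (a : ℝ) (L : ℕ) :
    vtxW' a (L + 1) = ∑ k ∈ range (L + 1),
      (if 2 * k ≤ L then vtxE a k * chiralCoeff (a + 1 + 2 * k) (L - 2 * k) else 0) := rfl

/-- `W_0 = 0`. [folklore] -/
@[simp] theorem vtxW_zero (a : ℝ) : vtxW a 0 = 0 := rfl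

/-- `W'_0 = 0`. [folklore] -/
@[simp] theorem vtxW'_zero (a : ℝ) : vtxW' a 0 = 0 := rfl

/-- **The Casimir recursion of the product coefficients** (coefficient form of
`(D - a(a-1))(k_2 k_{2a}) = 2x² k_{2a}'`): `(L+1)(2a+L) W_{L+1} = (a+L)² W_L + 2(a+L) κ_a(L)` (`a > 0`).
[folklore] -/
theorem vtxW_rec {a : ℝ} (ha : 0 < a) (L : ℕ) :
    ((L : ℝ) + 1) * (2 * a + L) * vtxW a (L + 1) =
      (a + L) ^ 2 * vtxW a L + 2 * (a + L) * chiralCoeff a L := by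
  cases L with
  | zero =>
    rw [vtxW_succ, vtxW_zero]
    simp
  | succ L =>
    rw [vtxW_succ, vtxW_succ, Finset.mul_sum, Finset.mul_sum]
    have h1 : ∀ p ∈ antidiagonal (L + 1),
        (((L + 1 : ℕ) : ℝ) + 1) * (2 * a + ((L + 1 : ℕ) : ℝ)) * (chiralCoeff a p.2 / ((p.1 : ℝ) + 1)) =
          (p.2 : ℝ) * (2 * a + p.2 - 1) * chiralCoeff a p.2 / ((p.1 : ℝ) + 1) +
            (2 * a + 2 * p.2 + p.1) * chiralCoeff a p.2 := by
      intro p hp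
      have hsum : (p.1 : ℝ) + p.2 = L + 1 := by exact_mod_cast mem_antidiagonal.mp hp
      have hL : ((L + 1 : ℕ) : ℝ) = p.1 + p.2 := by push_cast; linarith
      rw [hL]
      have : (p.1 : ℝ) + 1 ≠ 0 := by positivity
      field_simp
      ring
    rw [sum_congr rfl h1, sum_add_distrib]
    have hS1 : ∑ p ∈ antidiagonal (L + 1), (p.2 : ℝ) * (2 * a + p.2 - 1) * chiralCoeff a p.2 / ((p.1 : ℝ) + 1)
        = ∑ p ∈ antidiagonal L, (a + p.2) ^ 2 * chiralCoeff a p.2 / ((p.1 : ℝ) + 1) := by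
      rw [Nat.sum_antidiagonal_succ']
      simp only [Nat.cast_zero, zero_mul, zero_div, zero_add]
      refine sum_congr rfl fun p _ => ?_
      have h := chiralCoeff_succ_rec ha p.2
      push_cast
      rw [show 2 * a + ((p.2 : ℝ) + 1) - 1 = 2 * a + p.2 by ring]
      rw [show ((p.2 : ℝ) + 1) * (2 * a + p.2) * chiralCoeff a (p.2 + 1) / ((p.1 : ℝ) + 1)
          = (((p.2 : ℝ) + 1) * (2 * a + p.2) * chiralCoeff a (p.2 + 1)) / ((p.1 : ℝ) + 1) by ring, h]
    have hS2 : ∑ p ∈ antidiagonal (L + 1), (2 * a + 2 * (p.2 : ℝ) + p.1) * chiralCoeff a p.2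
        = 2 * (a + ((L + 1 : ℕ) : ℝ)) * chiralCoeff a (L + 1) +
          ∑ p ∈ antidiagonal L, (2 * a + 2 * (p.2 : ℝ) + p.1 + 1) * chiralCoeff a p.2 := by
      rw [Nat.sum_antidiagonal_succ]
      push_cast
      congr 1
      · ring
      · refine sum_congr rfl fun p _ => ?_
        ring
    rw [hS1, hS2]
    have hABC : ∑ p ∈ antidiagonal L, (a + p.2) ^ 2 * chiralCoeff a p.2 / ((p.1 : ℝ) + 1) +
        ∑ p ∈ antidiagonal L, (2 * a + 2 * (p.2 : ℝ) + p.1 + 1) * chiralCoeff a p.2 =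
        ∑ p ∈ antidiagonal L, (a + ((L + 1 : ℕ) : ℝ)) ^ 2 * (chiralCoeff a p.2 / ((p.1 : ℝ) + 1)) := by
      rw [← sum_add_distrib]
      refine sum_congr rfl fun p hp => ?_
      have hsum : (p.1 : ℝ) + p.2 = L := by exact_mod_cast mem_antidiagonal.mp hp
      have hL : ((L + 1 : ℕ) : ℝ) = p.1 + p.2 + 1 := by push_cast; linarith
      rw [hL]
      have : (p.1 : ℝ) + 1 ≠ 0 := by positivity
      field_simp
      ring
    linarith [hABC]

/-- **The same recursion for the block-side coefficients** (each `k_{2(a+1+2k)}` is a Casimir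
eigenfunction; the eigenvalue differences `2(2k+1)(a+k)` turn `E_k` into `c_k`, and `vtx_defect_sum`
evaluates the source): `(L+1)(2a+L) W'_{L+1} = (a+L)² W'_L + 2(a+L) κ_a(L)` (`a > 0`). [folklore] -/
theorem vtxW'_rec {a : ℝ} (ha : 0 < a) (L : ℕ) :
    ((L : ℝ) + 1) * (2 * a + L) * vtxW' a (L + 1) =
      (a + L) ^ 2 * vtxW' a L + 2 * (a + L) * chiralCoeff a L := by
  cases L with
  | zero =>
    rw [vtxW'_succ, vtxW'_zero, sum_range_one]
    simp [vtxE_zero ha]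
  | succ L =>
    have hD := vtx_defect_sum ha (L + 1)
    rw [sum_range_succ, if_neg (by omega), add_zero] at hD
    rw [vtxW'_succ, vtxW'_succ, sum_range_succ, if_neg (by omega), add_zero, mul_assoc (2 : ℝ), ← hD,
      Finset.mul_sum, Finset.mul_sum, Finset.mul_sum, ← sum_add_distrib]
    refine sum_congr rfl fun k _ => ?_
    by_cases h0 : 2 * k ≤ L
    · have h1 : 2 * k ≤ L + 1 := by omega
      rw [if_pos h1, if_pos h0, if_pos h1]
      obtain ⟨n, hn⟩ : ∃ n, L - 2 * k = n := ⟨_, rfl⟩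
      have hn1 : L + 1 - 2 * k = n + 1 := by omega
      rw [hn, hn1]
      have hrec := chiralCoeff_succ_rec (show 0 < a + 1 + 2 * k by positivity) n
      have hE := vtxE_mul ha k
      have hL : (L : ℝ) = n + 2 * k := by
        have : ((L - 2 * k : ℕ) : ℝ) = n := by exact_mod_cast hn
        rw [Nat.cast_sub h0] at this; push_cast at this; linarith
      push_cast
      rw [hL, ← hE]
      linear_combination (vtxE a k) * hrec
    · by_cases h1 : 2 * k ≤ L + 1
      · rw [if_pos h1, if_neg h0, if_pos h1, mul_zero, zero_add]
        have hk : L + 1 = 2 * k := by omega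
        have hn0 : L + 1 - 2 * k = 0 := by omega
        rw [hn0, chiralCoeff_zero_right, mul_one, mul_one, ← vtxE_mul ha k]
        have hL : (L : ℝ) = 2 * k - 1 := by
          have : ((L + 1 : ℕ) : ℝ) = ((2 * k : ℕ) : ℝ) := by rw [hk]
          push_cast at this; linarith
        push_cast
        rw [hL]
        ring
      · rw [if_neg h1, if_neg h0, if_neg h1]
        ring

/-- **The two coefficient sequences agree**: `W_M = W'_M` for all `M` (`a > 0`) — same first-order
recursion, same start. This is the coefficient identity behind `k_2 k_{2a} = Σ_k E_k(a) k_{2(a+1+2k)}`.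
[folklore] -/
theorem vtxW_eq_vtxW' {a : ℝ} (ha : 0 < a) : ∀ M : ℕ, vtxW a M = vtxW' a M
  | 0 => rfl
  | L + 1 => by
    have h1 := vtxW_rec ha L
    have h2 := vtxW'_rec ha L
    rw [vtxW_eq_vtxW' ha L] at h1
    have hne : ((L : ℝ) + 1) * (2 * a + L) ≠ 0 := by positivity
    exact mul_left_cancel₀ hne (h1.trans h2.symm)

/-! ### The charge-two family: `x^{2q}(1-x)^{-q} = Σ_k γ_k(q) k_{4q+4k}(x)` -/

/-- `γ_k(q)`, recursively: `γ_0 = 1`, `γ_{k+1}(q) = q² γ_k(q+1) / (2(k+1)(4q+2k+1))`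
(closed form `γ_k(q) = (q)_k² / (4^k k! (2q+k-1/2)_k)`; e.g. `γ_1(q) = q²/(2(4q+1))`). [folklore] -/
noncomputable def vtxGamma : ℕ → ℝ → ℝ
  | 0, _ => 1
  | k + 1, q => q ^ 2 * vtxGamma k (q + 1) / (2 * ((k : ℝ) + 1) * (4 * q + 2 * k + 1))

/-- `γ_0 = 1`. [folklore] -/
@[simp] theorem vtxGamma_zero (q : ℝ) : vtxGamma 0 q = 1 := rfl

/-- The defining recursion of `γ`. [folklore] -/
theorem vtxGamma_succ (k : ℕ) (q : ℝ) :
    vtxGamma (k + 1) q = q ^ 2 * vtxGamma k (q + 1) / (2 * ((k : ℝ) + 1) * (4 * q + 2 * k + 1)) := rfl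

/-- `γ_k(q) > 0` for `q > 0`. [folklore] -/
theorem vtxGamma_pos : ∀ (k : ℕ) {q : ℝ}, 0 < q → 0 < vtxGamma k q
  | 0, _, _ => by simp
  | k + 1, q, hq => by
    rw [vtxGamma_succ]
    have := vtxGamma_pos k (show 0 < q + 1 by linarith)
    positivity

/-- `2(k+1)(4q+2k+1) γ_{k+1}(q) = q² γ_k(q+1)`. [folklore] -/
theorem vtxGamma_succ_mul (k : ℕ) {q : ℝ} (hq : 0 < q) :
    2 * ((k : ℝ) + 1) * (4 * q + 2 * k + 1) * vtxGamma (k + 1) q = q ^ 2 * vtxGamma k (q + 1) := by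
  rw [vtxGamma_succ]
  have : 2 * ((k : ℝ) + 1) * (4 * q + 2 * k + 1) ≠ 0 := by positivity
  field_simp

/-- The power-series coefficients of `x^{2q}(1-x)^{-q} = Σ_m (q)_m/m! x^{2q+m}`. [folklore] -/
noncomputable def vtxY (q : ℝ) (m : ℕ) : ℝ := poch q m / (m.factorial : ℝ)

/-- The power-series coefficients of `Σ_k γ_k(q) k_{4q+4k}(x) = Σ_m WG_m x^{2q+m}`:
`WG_m = Σ_{2k ≤ m} γ_k(q) κ_{2q+2k}(m-2k)`. [folklore] -/
noncomputable def vtxWG (q : ℝ) (m : ℕ) : ℝ :=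
  ∑ k ∈ range (m + 1), if 2 * k ≤ m then vtxGamma k q * chiralCoeff (2 * q + 2 * k) (m - 2 * k) else 0

/-- **Casimir recursion of the monomial side** (coefficient form of
`D(x^{2q}(1-x)^{-q}) - 2q(2q-1) x^{2q}(1-x)^{-q} = q² x^{2q+2}(1-x)^{-(q+1)}`):
`(m+2)(4q+m+1) Y_{m+2}(q) = (2q+m+1)² Y_{m+1}(q) + q² Y_m(q+1)`. [folklore] -/
theorem vtxY_rec (q : ℝ) (m : ℕ) :
    ((m : ℝ) + 2) * (4 * q + m + 1) * vtxY q (m + 2) =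
      (2 * q + m + 1) ^ 2 * vtxY q (m + 1) + q ^ 2 * vtxY (q + 1) m := by
  unfold vtxY
  rw [show m + 2 = m + 1 + 1 by ring, poch_succ, Nat.factorial_succ, Nat.factorial_succ, poch_succ_left]
  have h1 : (m.factorial : ℝ) ≠ 0 := by positivity
  push_cast
  field_simp
  ring

/-- `Y_0 = 1`, `Y_1 = q`. [folklore] -/
theorem vtxY_zero_one (q : ℝ) : vtxY q 0 = 1 ∧ vtxY q 1 = q := by
  unfold vtxY; simp

/-- `WG_0 = 1`, `WG_1 = q` (`q > 0`). [folklore] -/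
theorem vtxWG_zero_one {q : ℝ} (hq : 0 < q) : vtxWG q 0 = 1 ∧ vtxWG q 1 = q := by
  unfold vtxWG
  constructor
  · simp
  · rw [sum_range_succ, sum_range_one, if_pos (by norm_num), if_neg (by norm_num)]
    simp only [vtxGamma_zero, Nat.cast_zero, mul_zero, add_zero, one_mul, Nat.sub_zero]
    rw [chiralCoeff_one_right (by positivity)]
    ring

/-- **Casimir recursion of the block side** (each `k_{4q+4k}` is an eigenfunction; the eigenvalue
differences `2k(4q+2k-1)` shift `γ_k(q)` to `q² γ_{k-1}(q+1)`):
`(m+2)(4q+m+1) WG_{m+2}(q) = (2q+m+1)² WG_{m+1}(q) + q² WG_m(q+1)` (`q > 0`). [folklore] -/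
theorem vtxWG_rec {q : ℝ} (hq : 0 < q) (m : ℕ) :
    ((m : ℝ) + 2) * (4 * q + m + 1) * vtxWG q (m + 2) =
      (2 * q + m + 1) ^ 2 * vtxWG q (m + 1) + q ^ 2 * vtxWG (q + 1) m := by
  unfold vtxWG
  have hS1 : (∑ k ∈ range (m + 2 + 1),
      (if 2 * k ≤ m + 2 then vtxGamma k q * chiralCoeff (2 * q + 2 * k) (m + 2 - 2 * k) else 0)) =
      (∑ k ∈ range (m + 1), (if 2 * (k + 1) ≤ m + 2 then
        vtxGamma (k + 1) q * chiralCoeff (2 * q + 2 * ((k + 1 : ℕ) : ℝ)) (m + 2 - 2 * (k + 1)) else 0)) +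
      chiralCoeff (2 * q) (m + 2) := by
    rw [sum_range_succ', sum_range_succ, if_neg (by omega), add_zero]
    simp
  have hS2 : (∑ k ∈ range (m + 1 + 1),
      (if 2 * k ≤ m + 1 then vtxGamma k q * chiralCoeff (2 * q + 2 * k) (m + 1 - 2 * k) else 0)) =
      (∑ k ∈ range (m + 1), (if 2 * (k + 1) ≤ m + 1 then
        vtxGamma (k + 1) q * chiralCoeff (2 * q + 2 * ((k + 1 : ℕ) : ℝ)) (m + 1 - 2 * (k + 1)) else 0)) +
      chiralCoeff (2 * q) (m + 1) := by
    rw [sum_range_succ']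
    simp
  rw [hS1, hS2, mul_add (((m : ℝ) + 2) * (4 * q + m + 1)), mul_add ((2 * q + m + 1) ^ 2),
    Finset.mul_sum, Finset.mul_sum, Finset.mul_sum]
  have key : ∀ k ∈ range (m + 1),
      ((m : ℝ) + 2) * (4 * q + m + 1) *
          (if 2 * (k + 1) ≤ m + 2 then vtxGamma (k + 1) q * chiralCoeff (2 * q + 2 * ((k + 1 : ℕ) : ℝ))
            (m + 2 - 2 * (k + 1)) else 0) =
        (2 * q + m + 1) ^ 2 *
          (if 2 * (k + 1) ≤ m + 1 then vtxGamma (k + 1) q * chiralCoeff (2 * q + 2 * ((k + 1 : ℕ) : ℝ))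
            (m + 1 - 2 * (k + 1)) else 0) +
        q ^ 2 * (if 2 * k ≤ m then vtxGamma k (q + 1) * chiralCoeff (2 * (q + 1) + 2 * k) (m - 2 * k)
            else 0) := by
    intro k _
    have hG := vtxGamma_succ_mul k hq
    have hh : 2 * (q + 1) + 2 * (k : ℝ) = 2 * q + 2 * ((k + 1 : ℕ) : ℝ) := by push_cast; ring
    by_cases h0 : 2 * (k + 1) ≤ m + 1
    · have h1 : 2 * (k + 1) ≤ m + 2 := by omega
      have h2 : 2 * k ≤ m := by omega
      rw [if_pos h1, if_pos h0, if_pos h2, hh]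
      obtain ⟨n, hn⟩ : ∃ n, m + 1 - 2 * (k + 1) = n := ⟨_, rfl⟩
      have hn1 : m + 2 - 2 * (k + 1) = n + 1 := by omega
      have hn2 : m - 2 * k = n + 1 := by omega
      rw [hn, hn1, hn2]
      have hrec := chiralCoeff_succ_rec (show 0 < 2 * q + 2 * ((k + 1 : ℕ) : ℝ) by positivity) n
      have hm : (m : ℝ) = n + 2 * k + 1 := by
        have : ((m + 1 - 2 * (k + 1) : ℕ) : ℝ) = n := by exact_mod_cast hn
        rw [Nat.cast_sub h0] at this; push_cast at this; linarith
      rw [hm]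
      push_cast
      push_cast at hrec hG
      linear_combination (vtxGamma (k + 1) q) * hrec + (chiralCoeff (2 * q + 2 * ((k : ℝ) + 1)) (n + 1)) * hG
    · by_cases h1 : 2 * (k + 1) ≤ m + 2
      · have h2 : 2 * k ≤ m := by omega
        have hk : m + 2 = 2 * (k + 1) := by omega
        rw [if_pos h1, if_neg h0, if_pos h2, hh, show m + 2 - 2 * (k + 1) = 0 by omega,
          show m - 2 * k = 0 by omega, chiralCoeff_zero_right, mul_one, mul_one,
          mul_zero, zero_add, ← hG]
        have hm : (m : ℝ) = 2 * k := by
          have : ((m + 2 : ℕ) : ℝ) = ((2 * (k + 1) : ℕ) : ℝ) := by rw [hk]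
          push_cast at this; linarith
        rw [hm]
        ring
      · have h2 : ¬ 2 * k ≤ m := by omega
        rw [if_neg h1, if_neg h0, if_neg h2]
        ring
  rw [sum_congr rfl key, sum_add_distrib]
  have e0 : ((m : ℝ) + 2) * (4 * q + m + 1) * chiralCoeff (2 * q) (m + 2) =
      (2 * q + m + 1) ^ 2 * chiralCoeff (2 * q) (m + 1) := by
    have h := chiralCoeff_succ_rec (show 0 < 2 * q by linarith) (m + 1)
    push_cast at h
    rw [show m + 1 + 1 = m + 2 by ring] at h
    linear_combination h
  rw [e0]
  ring

/-- **The two coefficient sequences agree**: `Y_m(q) = WG_m(q)` for all `m` and all `q > 0` (same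
two-step recursion in `m`, shifting `q ↦ q + 1`, same two initial values). This is the coefficient
identity behind `x^{2q}(1-x)^{-q} = Σ_k γ_k(q) k_{4q+4k}(x)`. [folklore] -/
theorem vtxY_eq_vtxWG : ∀ (m : ℕ) {q : ℝ}, 0 < q → vtxY q m = vtxWG q m
  | 0, q, hq => by rw [(vtxY_zero_one q).1, (vtxWG_zero_one hq).1]
  | 1, q, hq => by rw [(vtxY_zero_one q).2, (vtxWG_zero_one hq).2]
  | m + 2, q, hq => by
    have h1 := vtxY_rec q m
    have h2 := vtxWG_rec hq m
    rw [vtxY_eq_vtxWG (m + 1) hq, vtxY_eq_vtxWG m (show 0 < q + 1 by linarith)] at h1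
    have hne : ((m : ℝ) + 2) * (4 * q + m + 1) ≠ 0 := by positivity
    exact mul_left_cancel₀ hne (h1.trans h2.symm)

end Summit.CriticalPhenomena.Ising3D.Control2D
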